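import Literature.ModelTheory.ExponentialFields.PilaWilkieReparamSucc
import Literature.ModelTheory.ExponentialFields.PilaWilkieUniformReparamLow
import Literature.ModelTheory.ExponentialFields.PilaWilkieReparamTools
import Literature.ModelTheory.ExponentialFields.PilaWilkieCountingFamilies
import HarnessLib

/-!
# The Pila–Wilkie counting theorem (Pila–Wilkie 2006, Thm. 1.8): the discharge

Topic `Literature/ModelTheory/ExponentialFields`.  This file closes the named fact
`PilaWilkie2006_thm_1_8` of `PilaWilkieCounting.lean`:

* `uniformReparam` — the **uniform `r`-reparametrization property `UR(r, ℓ)` for all `r`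
  and `ℓ`** over any o-minimal structure on `ℝ` in which the graphs of `+` and `·` are
  definable (the o-minimal reparametrization theorem, Pila–Wilkie 2006, Thm. 2.3/Cor. 5.1;
  Bhardwaj–van den Dries 2022, Thm. 4.3/`(I)_m` of §7, here uniformly in parameters): by
  induction on `ℓ` from `uniformReparam_zero` and `uniformReparam_succ` for `r ≥ 1`, and
  `uniformReparam_mono` for `r = 0`;
* **`PilaWilkie2006_thm_1_8_holds : PilaWilkie2006_thm_1_8`** — the counting theorem, by
  `PilaWilkie2006_thm_1_8_of_uniformReparam` (the reduction through Bhardwaj–van den Dries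
  2022, Thm. 2.4/§8 and Pila–Wilkie 2006, Prop. 6.1, landed in `PilaWilkieCountingFamilies`).

Nothing here is a named fact; no definitions.

## References

* J. Pila, A. J. Wilkie, *The rational points of a definable set*, Duke Math. J. 133 (2006),
  591–616, Thm. 1.8, Thm. 2.3, Cor. 5.1. [PilaWilkie2006]
* N. Bhardwaj, L. van den Dries, *On the Pila–Wilkie theorem*, Expo. Math. 40 (2022),
  495–542, Thm. 4.3, §7, §8. [BhardwajVanDenDries2022]
-/

noncomputable section

open Set FirstOrder FirstOrder.Language Filter Topology Function

namespace Literature.ModelTheory.ExponentialFields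

section Final

variable {L : FirstOrder.Language.{0, 0}} [L.Structure ℝ]

/-- Local notation: the open unit cube `(0,1)^ℓ`. -/
local notation "𝕀^" ℓ:max => (Set.pi Set.univ fun _ : Fin ℓ => Set.Ioo (0 : ℝ) 1)

/-- **The uniform reparametrization theorem** (Pila–Wilkie 2006, Thm. 2.3 and Cor. 5.1;
Bhardwaj–van den Dries 2022, Thm. 4.3 with the uniformity of their Appendix B), over an
o-minimal structure on `ℝ` in which `+` and `·` have definable graphs: for all `r, ℓ` and every
finite tuple of definable families `F_l(v, ·)` of functions `(0,1)^ℓ → [−1, 1]`, finitely many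
definable families of `C^r` charts `ψ_j(v, ·) : (0,1)^ℓ → (0,1)^ℓ` with `‖D^q ψ_j‖ ≤ 1`,
covering `(0,1)^ℓ`, with all `F_l(v,·) ∘ ψ_j(v,·)` of class `C^r` with `‖D^q‖ ≤ 1` (`q ≤ r`).
[cite: PilaWilkie2006, Thm. 2.3, Cor. 5.1] [cite: BhardwajVanDenDries2022, Thm. 4.3, §7] -/
theorem uniformReparam (hO : L.IsOMinimal ℝ)
    (hadd : (univ : Set ℝ).Definable L {v : Fin 3 → ℝ | v 0 + v 1 = v 2})
    (hmul : (univ : Set ℝ).Definable L {v : Fin 3 → ℝ | v 0 * v 1 = v 2}) (r ℓ : ℕ)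
    (n m : ℕ) (F : Fin n → (Fin m → ℝ) → (Fin ℓ → ℝ) → ℝ)
    (hF : ∀ l, IsDefinableFamily L (F l)) (hbd : ∀ l v, ∀ x ∈ 𝕀^ℓ, |F l v x| ≤ 1) :
    ∃ (κ : Type) (_ : Fintype κ) (ψ : κ → (Fin m → ℝ) → (Fin ℓ → ℝ) → (Fin ℓ → ℝ)),
      (∀ j c, IsDefinableFamily L (fun v x => ψ j v x c)) ∧
      ∀ v, (∀ j, MapsTo (ψ j v) (𝕀^ℓ) (𝕀^ℓ)) ∧ (⋃ j, ψ j v '' 𝕀^ℓ) = 𝕀^ℓ ∧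
        (∀ j c, ContDiffOn ℝ r (fun x => ψ j v x c) (𝕀^ℓ)) ∧
        (∀ j c, ∀ q ≤ r, ∀ x ∈ 𝕀^ℓ, ‖iteratedFDeriv ℝ q (fun x => ψ j v x c) x‖ ≤ 1) ∧
        (∀ j l, ContDiffOn ℝ r (fun x => F l v (ψ j v x)) (𝕀^ℓ)) ∧
        (∀ j l, ∀ q ≤ r, ∀ x ∈ 𝕀^ℓ, ‖iteratedFDeriv ℝ q (fun x => F l v (ψ j v x)) x‖ ≤ 1) := by
  -- the statement `UR(k, ℓ)` for `k ≥ 1`, all `ℓ`, by strong induction on `ℓ`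
  have hpos : ∀ (k : ℕ), 1 ≤ k → ∀ (ℓ : ℕ) (n m : ℕ) (F : Fin n → (Fin m → ℝ) → (Fin ℓ → ℝ) → ℝ),
      (∀ l, IsDefinableFamily L (F l)) → (∀ l v, ∀ x ∈ 𝕀^ℓ, |F l v x| ≤ 1) →
      ∃ (κ : Type) (_ : Fintype κ) (ψ : κ → (Fin m → ℝ) → (Fin ℓ → ℝ) → (Fin ℓ → ℝ)),
        (∀ j c, IsDefinableFamily L (fun v x => ψ j v x c)) ∧
        ∀ v, (∀ j, MapsTo (ψ j v) (𝕀^ℓ) (𝕀^ℓ)) ∧ (⋃ j, ψ j v '' 𝕀^ℓ) = 𝕀^ℓ ∧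
          (∀ j c, ContDiffOn ℝ k (fun x => ψ j v x c) (𝕀^ℓ)) ∧
          (∀ j c, ∀ q ≤ k, ∀ x ∈ 𝕀^ℓ, ‖iteratedFDeriv ℝ q (fun x => ψ j v x c) x‖ ≤ 1) ∧
          (∀ j l, ContDiffOn ℝ k (fun x => F l v (ψ j v x)) (𝕀^ℓ)) ∧
          (∀ j l, ∀ q ≤ k, ∀ x ∈ 𝕀^ℓ, ‖iteratedFDeriv ℝ q (fun x => F l v (ψ j v x)) x‖ ≤ 1) := by
    intro k hk ℓ
    induction ℓ using Nat.strong_induction_on with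
    | _ ℓ ih =>
      rcases ℓ with _ | m'
      · intro n m F hF hbd; exact uniformReparam_zero n m F hF hbd
      · exact uniformReparam_succ hO hadd hmul hk (fun ℓ' hℓ' => ih ℓ' (by omega))
  rcases Nat.eq_zero_or_pos r with hr | hr
  · subst hr
    exact uniformReparam_mono (Nat.zero_le 1) (hpos 1 le_rfl ℓ) n m F hF hbd
  · exact hpos r hr ℓ n m F hF hbd

end Final

/-- **The Pila–Wilkie counting theorem** (Pila–Wilkie 2006, Thm. 1.8): the named fact
`PilaWilkie2006_thm_1_8` holds — for every o-minimal structure on `ℝ` in which the graphs of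
addition and multiplication are definable, every definable `X ⊆ ℝ^n` and every `ε > 0` there
is `c = c(X, ε)` with `N(X^{trans}, H) ≤ c H^ε` for all `H ≥ 1`.  Proof: the uniform
reparametrization theorem `uniformReparam` feeds the reduction
`PilaWilkie2006_thm_1_8_of_uniformReparam` (uniform strong parametrization of definable
families, the Main Lemma via Bombieri–Pila, and the induction on fibre dimension through
semialgebraic cells of Bhardwaj–van den Dries 2022, §2/§8).
[cite: PilaWilkie2006, Thm. 1.8] [cite: BhardwajVanDenDries2022, Thm. 8.3] -/
theorem PilaWilkie2006_thm_1_8_holds : PilaWilkie2006_thm_1_8 :=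
  PilaWilkie2006_thm_1_8_of_uniformReparam fun L _ hO hadd hmul r ℓ n' m F hF hbd =>
    uniformReparam (L := L) hO hadd hmul r ℓ n' m F hF hbd

end Literature.ModelTheory.ExponentialFields

end
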